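import Summits.AnomalousDissipation.AnomalousDissipation.Theorems.SolenoidalFractalHomogenisationLagrangianStepVmodLossAdjOnsetCore
import HarnessLib

/-!
# K1L_D (stmt-AnomalousDissipation-27980), (ℓ3-A) road A, (S2-adj) glue: the onset pairing as a GRADIENT FORM, and the DIAGONAL onset bound
# `Q_σ(J(t₀−σ)•φ₀) − σ·N·‖g_σ‖₂ ≤ D(σ)` (dual field := the co-moving corrected test itself)
(helper; `--supports 27980 --as helper`; prover ad-k1loc-p3 g12; continues p732357 `EnergyDuhamelG.exists_adjWitness_onsetCore`.)

CONVENTION (D28-8′): derivative-index distortion `Torus.Visc4.conj`; constraint `∇·(G v) = 0`.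

* §1 **`neg_integral_inner_viscAdjVar_add_transpose_eq`** — for a smooth coefficient field `𝔹` and smooth `χ, ψ`:
  `−∫⟪𝓛^{𝔹,*}χ + 𝓛^{𝔹ᵀ,*}χ, ψ⟫ = ∫ Σ_{i,c,j,e} 𝔹_{icje}((∂_cχ)_i(∂_eψ)_j + (∂_cψ)_i(∂_eχ)_j)` (one IBP each, `Torus.integral_inner_viscAdjVar_eq_neg`,
  and the relabelling `𝔹ᵀ_{icje} = 𝔹_{jeic}`): the onset pairing of p732357 is the SYMMETRISED gradient form — on the diagonal `ψ = χ` it is `2·Q(χ)`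
  EXACTLY (`neg_integral_inner_viscAdjVar_add_transpose_self`), no commutator and no `O(θ)`.
* §2 **`EnergyDuhamelG.exists_adjWitness_onsetDiag`** — p732357 with the dual field `χ := J(t₀−σ)•φ₀` (smooth AND admissible) and `λ := 1`:
  for a.e. `σ ∈ (0,t₀)`,  `Q_σ(J(t₀−σ)•φ₀) − σ·N·‖g_σ(J(t₀−σ)•φ₀)‖_{L²} ≤ D(σ)`,
  `Q_σ(χ) = ∫Σ(𝔸Tᵀ)^{G(t₀−σ)}∂χ∂χ` — the adjoint dissipation density at reversed time `σ` is at least the (twisted) energy form of the corrected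
  test at that time minus the generator remainder.  `Q_σ(J•φ₀)` is bounded below by the smooth twisted Gårding inequality (E2′ §5
  `integral_inner_viscAdjVar_conj_self_le_of_isDivFree_distort`, the test IS `G`-solenoidal), so the (S2-adj) short row needs NO weak-gradient Gårding;
  what remains is the size of `N·‖g_σ‖` (F-p3g12-1) and the time integration (`two_setIntegral_le_of_le_density`, p730365).
`sorry`-free; NOT a proof of any block, of K1L_D or of AD; rung F-D1.A0.
-/

set_option linter.dupNamespace false

noncomputable section

namespace Summit.AnomalousDissipation.AnomalousDissipation.Theorems.SolenoidalFractalHomogenisation.LagrangianStep.VmodDist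

open Literature.Analysis Literature.Analysis.FluidPDE Literature.Analysis.FunctionSpaces
open MeasureTheory Set Filter Function
open scoped ENNReal NNReal InnerProductSpace
open Summit.AnomalousDissipation.AnomalousDissipation.Theorems.SolenoidalFractalHomogenisation.LagrangianStep.CellClauseMod
open Summit.AnomalousDissipation.AnomalousDissipation.Theorems.SolenoidalFractalHomogenisation.LagrangianStep.CellEnergyT

/-! ## §1 The onset pairing is the symmetrised gradient form -/

/-- Relabelling `(i,c,j,e) ↦ (j,e,i,c)` of the transposed bilinear gradient form (a `3⁴`-term identity). -/
private theorem sum₄_transpose_relabel (𝔹₀ : Torus.Visc4 (Fin 3)) (a b : Fin 3 → Fin 3 → ℝ) :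
    ∑ i, ∑ c, ∑ j, ∑ e, 𝔹₀ j e i c * a c i * b e j = ∑ i, ∑ c, ∑ j, ∑ e, 𝔹₀ i c j e * b c i * a e j := by
  simp only [Fin.sum_univ_three]
  ring

/-- Moving the outermost of three finite sums innermost. -/
private theorem sum_rotate₃' {α : Type*} [AddCommMonoid α] (f : Fin 3 → Fin 3 → Fin 3 → α) :
    ∑ x, ∑ y, ∑ z, f x y z = ∑ y, ∑ z, ∑ x, f x y z := by
  rw [Finset.sum_comm]
  exact Finset.sum_congr rfl fun y _ => Finset.sum_comm

/-- The `L²` pairing against the TRANSPOSED test operator is the gradient form with the two gradients exchanged: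
`∫⟪ψ, 𝓛^{𝔹ᵀ,*}χ⟫ = −∫ Σ 𝔹_{icje} (∂_cψ)_i (∂_eχ)_j`. -/
theorem integral_inner_viscAdjVar_transpose_eq_neg {𝔹 : UnitAddTorus (Fin 3) → Torus.Visc4 (Fin 3)}
    (h𝔹 : ∀ i c j e, Torus.IsSmooth (fun y => 𝔹 y i c j e)) {χ ψ : VF} (hχ : Torus.IsSmooth χ) (hψ : Torus.IsSmooth ψ) :
    ∫ x, ⟪ψ x, Torus.viscAdjVar (fun y => Torus.majorTranspose (𝔹 y)) χ x⟫_ℝ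
      = -∫ x, ∑ i, ∑ c, ∑ j, ∑ e, 𝔹 x i c j e * (Torus.partialDeriv c ψ x) i * (Torus.partialDeriv e χ x) j := by
  have h𝔹t : ∀ i c j e, Torus.IsSmooth (fun y => Torus.majorTranspose (𝔹 y) i c j e) := fun i c j e => by
    simp only [Torus.majorTranspose_apply]; exact h𝔹 j e i c
  rw [Torus.integral_inner_viscAdjVar_eq_neg h𝔹t hψ hχ]
  congr 1
  refine integral_congr_ae (Eventually.of_forall fun x => ?_)
  simp only [Torus.majorTranspose_apply]
  exact sum₄_transpose_relabel (𝔹 x) (fun c i => (Torus.partialDeriv c χ x) i) (fun e j => (Torus.partialDeriv e ψ x) j)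

/-- **The onset pairing is the symmetrised gradient form**: `−∫⟪𝓛^{𝔹,*}χ + 𝓛^{𝔹ᵀ,*}χ, ψ⟫ = ∫ Σ 𝔹_{icje}((∂_cχ)_i(∂_eψ)_j + (∂_cψ)_i(∂_eχ)_j)`. -/
theorem neg_integral_inner_viscAdjVar_add_transpose_eq {𝔹 : UnitAddTorus (Fin 3) → Torus.Visc4 (Fin 3)}
    (h𝔹 : ∀ i c j e, Torus.IsSmooth (fun y => 𝔹 y i c j e)) {χ ψ : VF} (hχ : Torus.IsSmooth χ) (hψ : Torus.IsSmooth ψ) :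
    -(∫ x, ⟪Torus.viscAdjVar 𝔹 χ x + Torus.viscAdjVar (fun y => Torus.majorTranspose (𝔹 y)) χ x, ψ x⟫_ℝ)
      = ∫ x, ∑ i, ∑ c, ∑ j, ∑ e, 𝔹 x i c j e *
          ((Torus.partialDeriv c χ x) i * (Torus.partialDeriv e ψ x) j + (Torus.partialDeriv c ψ x) i * (Torus.partialDeriv e χ x) j) := by
  have h𝔹t : ∀ i c j e, Torus.IsSmooth (fun y => Torus.majorTranspose (𝔹 y) i c j e) := fun i c j e => by
    simp only [Torus.majorTranspose_apply]; exact h𝔹 j e i c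
  have hg₁ : Torus.IsSmooth (Torus.viscAdjVar 𝔹 χ) := Torus.isSmooth_viscAdjVar h𝔹 hχ
  have hg₂ : Torus.IsSmooth (Torus.viscAdjVar (fun y => Torus.majorTranspose (𝔹 y)) χ) := Torus.isSmooth_viscAdjVar h𝔹t hχ
  have e0 : ∫ x, ⟪Torus.viscAdjVar 𝔹 χ x + Torus.viscAdjVar (fun y => Torus.majorTranspose (𝔹 y)) χ x, ψ x⟫_ℝ
      = (∫ x, ⟪ψ x, Torus.viscAdjVar 𝔹 χ x⟫_ℝ) + ∫ x, ⟪ψ x, Torus.viscAdjVar (fun y => Torus.majorTranspose (𝔹 y)) χ x⟫_ℝ := by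
    rw [integral_inner_add_smooth (hψ.memLp 2) hg₁ hg₂]
    exact integral_congr_ae (Eventually.of_forall fun x => real_inner_comm _ _)
  rw [e0, Torus.integral_inner_viscAdjVar_eq_neg h𝔹 hψ hχ, integral_inner_viscAdjVar_transpose_eq_neg h𝔹 hχ hψ]
  -- integrability of the two gradient forms (continuous on the compact torus)
  have hc : ∀ {φ₁ φ₂ : VF}, Torus.IsSmooth φ₁ → Torus.IsSmooth φ₂ →
      Integrable (fun x => ∑ i, ∑ c, ∑ j, ∑ e, 𝔹 x i c j e * (Torus.partialDeriv c φ₁ x) i * (Torus.partialDeriv e φ₂ x) j) volume := by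
    intro φ₁ φ₂ h₁ h₂
    refine (continuous_finsetSum _ fun i _ => continuous_finsetSum _ fun c _ => continuous_finsetSum _ fun j _ =>
      continuous_finsetSum _ fun e _ => ?_).integrable_unitAddTorus
    exact (((h𝔹 i c j e).continuous.mul ((PiLp.continuous_apply 2 (fun _ : Fin 3 => ℝ) i).comp (h₁.partialDeriv c).continuous)).mul
      ((PiLp.continuous_apply 2 (fun _ : Fin 3 => ℝ) j).comp (h₂.partialDeriv e).continuous))
  rw [← neg_add, neg_neg, ← integral_add (hc hχ hψ) (hc hψ hχ)]
  refine integral_congr_ae (Eventually.of_forall fun x => ?_)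
  simp only [← Finset.sum_add_distrib]
  exact Finset.sum_congr rfl fun i _ => Finset.sum_congr rfl fun c _ => Finset.sum_congr rfl fun j _ =>
    Finset.sum_congr rfl fun e _ => by ring

/-- **On the diagonal the onset pairing is twice the energy form, EXACTLY**: `−∫⟪𝓛^{𝔹,*}χ + 𝓛^{𝔹ᵀ,*}χ, χ⟫ = 2·∫ Σ_{l,i,c,e} 𝔹_{icle}(∂_cχ)_i(∂_eχ)_l`
(in the summation order of `EnergyIdG(Adj)`). -/
theorem neg_integral_inner_viscAdjVar_add_transpose_self {𝔹 : UnitAddTorus (Fin 3) → Torus.Visc4 (Fin 3)}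
    (h𝔹 : ∀ i c j e, Torus.IsSmooth (fun y => 𝔹 y i c j e)) {χ : VF} (hχ : Torus.IsSmooth χ) :
    -(∫ x, ⟪Torus.viscAdjVar 𝔹 χ x + Torus.viscAdjVar (fun y => Torus.majorTranspose (𝔹 y)) χ x, χ x⟫_ℝ)
      = 2 * ∫ x, ∑ l, ∑ i, ∑ c, ∑ e, 𝔹 x i c l e * (Torus.partialDeriv c χ x) i * (Torus.partialDeriv e χ x) l := by
  rw [neg_integral_inner_viscAdjVar_add_transpose_eq h𝔹 hχ hχ, ← integral_const_mul]
  refine integral_congr_ae (Eventually.of_forall fun x => ?_)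
  simp only
  rw [sum_rotate₃' fun l i c => ∑ e, 𝔹 x i c l e * (Torus.partialDeriv c χ x) i * (Torus.partialDeriv e χ x) l, Finset.mul_sum]
  refine Finset.sum_congr rfl fun i _ => ?_
  rw [Finset.mul_sum]
  refine Finset.sum_congr rfl fun c _ => ?_
  rw [Finset.mul_sum]
  refine Finset.sum_congr rfl fun j _ => ?_
  rw [Finset.mul_sum]
  exact Finset.sum_congr rfl fun e _ => by ring

/-! ## §2 The diagonal onset bound -/

variable {Tw θ nC : ℝ} {𝔸U 𝔸T : Torus.Visc4 (Fin 3)} {bU : ℝ → VF} {G J J' : ℝ → UnitAddTorus (Fin 3) → Matrix (Fin 3) (Fin 3) ℝ}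
  {U T : ℝ → ℝ → (V2 →L[ℝ] V2)} {φ₀ : VF}

set_option maxHeartbeats 800000 in
/-- **(S2-adj) DIAGONAL ONSET BOUND.**  Under the hypotheses of `EnergyDuhamelG.exists_adjWitness_onsetCore` (p732357): the pinned adjoint witness
`(Ψ, DΨ)` of the coarse member at the block test `ζ = [J(t₀)•φ₀]`, its clauses and loss formula, and for a.e. `σ ∈ (0,t₀)`, with the co-moving
corrected test `χ_σ = J(t₀−σ)•φ₀` and `g_σ = 𝓛^{𝔸T^{G(t₀−σ)},*}χ_σ + 𝓛^{(𝔸Tᵀ)^{G(t₀−σ)},*}χ_σ`: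
`Q_σ(χ_σ) − σ·N·‖g_σ‖_{L²} ≤ D(σ)`,  `Q_σ(χ) = ∫Σ(𝔸Tᵀ)^{G(t₀−σ)}∂χ∂χ`, `D(σ) = ∫Σ(𝔸Tᵀ)^{G(t₀−σ)}(DΨ σ)(DΨ σ)`. -/
theorem EnergyDuhamelG.exists_adjWitness_onsetDiag (hED : EnergyDuhamelG Tw 𝔸U 𝔸T bU G U T)
    (hT : IsDistortedPropagator Tw 𝔸T (fun _ _ => 0) G T) (hG : IsFrameModulation θ Tw nC G) (hR : IsFrameRegular θ Tw nC G J)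
    (hsolT : ∀ s, 0 ≤ s → s < Tw → ∀ (φ : VF) (hφ : MemLp φ 2 volume), Torus.IsWeaklyDivFree (Torus.distort (G s) φ) → ∃ w : ℝ → VF,
      Torus.IsWeakTensorPassiveVectorDistortedOn 0 (Tw - s) 𝔸T (fun _ _ => 0) (fun τ => G (s + τ)) φ w)
    (hQ : ∀ ξ : Fin 3 → Fin 3 → ℝ, 0 ≤ ∑ l, ∑ i, ∑ c, ∑ e, 𝔸T i c l e * ξ c i * ξ e l)
    (hφs : Torus.IsSmooth φ₀) (hφdiv : Torus.IsDivFree φ₀)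
    (hJ' : ∀ᵐ t ∂(volume.restrict (Ioo 0 Tw)), ∀ y, HasDerivAt (fun s => J s y) (J' t y) t)
    {N : ℝ} (hN0 : 0 ≤ N)
    (hN : ∀ᵐ τ ∂(volume.restrict (Ioo 0 Tw)),
      MemLp (fun x => Torus.distort (J' τ) φ₀ x + Torus.convect (fun _ => 0) (Torus.distort (J τ) φ₀) x +
          Torus.viscAdjVar (fun y => Torus.Visc4.conj (G τ y) 𝔸T) (Torus.distort (J τ) φ₀) x) 2 volume ∧
      eLpNorm (fun x => Torus.distort (J' τ) φ₀ x + Torus.convect (fun _ => 0) (Torus.distort (J τ) φ₀) x +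
          Torus.viscAdjVar (fun y => Torus.Visc4.conj (G τ y) 𝔸T) (Torus.distort (J τ) φ₀) x) 2 volume ≤ ENNReal.ofReal N)
    {t₀ : ℝ} (ht₀ : 0 < t₀) (ht₀T : t₀ ≤ Tw) :
    ∃ (Ψ : ℝ → VF) (DΨ : ℝ → Fin 3 → VF),
      Torus.IsWeakTensorPassiveVectorDistortedOn 0 t₀ (Torus.majorTranspose 𝔸T) (revCarrier (fun _ _ => 0) t₀) (fun σ => G (t₀ - σ))
        (((((Torus.isSmooth_distort (hR.smooth t₀) hφs).memLp 2).toLp (Torus.distort (J t₀) φ₀) : V2) : V2) : VF) Ψ ∧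
      (∀ c, MemLp (uncurry (DΨ · c)) 2 (((volume : Measure ℝ).restrict (Ioo 0 t₀)).prod volume)) ∧
      (∀ᵐ σ ∂(volume.restrict (Ioo 0 t₀)), ∀ c, Torus.HasWeakPartialDeriv c (Ψ σ) (DΨ σ c)) ∧
      (∀ s ∈ Ico 0 t₀, lossAdj (T s t₀) (((Torus.isSmooth_distort (hR.smooth t₀) hφs).memLp 2).toLp (Torus.distort (J t₀) φ₀)) =
        2 * ∫ σ in Ioc 0 (t₀ - s), ∫ x, ∑ l, ∑ i, ∑ c, ∑ e,
          Torus.Visc4.conj (G (t₀ - σ) x) (Torus.majorTranspose 𝔸T) i c l e * (DΨ σ c x) i * (DΨ σ e x) l) ∧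
      ∀ᵐ σ ∂(volume.restrict (Ioo 0 t₀)),
        (∫ x, ∑ l, ∑ i, ∑ c, ∑ e, Torus.Visc4.conj (G (t₀ - σ) x) (Torus.majorTranspose 𝔸T) i c l e
            * (Torus.partialDeriv c (Torus.distort (J (t₀ - σ)) φ₀) x) i * (Torus.partialDeriv e (Torus.distort (J (t₀ - σ)) φ₀) x) l)
          - σ * N * (eLpNorm (fun x => Torus.viscAdjVar (fun y => Torus.Visc4.conj (G (t₀ - σ) y) 𝔸T) (Torus.distort (J (t₀ - σ)) φ₀) x +
              Torus.viscAdjVar (fun y => Torus.Visc4.conj (G (t₀ - σ) y) (Torus.majorTranspose 𝔸T)) (Torus.distort (J (t₀ - σ)) φ₀) x)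
              2 volume).toReal
          ≤ ∫ x, ∑ l, ∑ i, ∑ c, ∑ e,
              Torus.Visc4.conj (G (t₀ - σ) x) (Torus.majorTranspose 𝔸T) i c l e * (DΨ σ c x) i * (DΨ σ e x) l := by
  have hTw : 0 ≤ Tw := ht₀.le.trans ht₀T
  have hGs : ∀ t i j, Torus.IsSmooth (fun y => G t y i j) := fun t i j => hG.smooth_all hTw t i j
  obtain ⟨Ψ, DΨ, hcl, hM, hD, hloss, hae⟩ := hED.exists_adjWitness_onsetCore hT hG hR hsolT hQ hφs hφdiv hJ' hN0 hN ht₀ ht₀T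
  refine ⟨Ψ, DΨ, hcl, hM, hD, hloss, ?_⟩
  filter_upwards [hae] with σ hσ
  set χ : VF := Torus.distort (J (t₀ - σ)) φ₀ with hχdef
  have hχs : Torus.IsSmooth χ := Torus.isSmooth_distort (hR.smooth (t₀ - σ)) hφs
  have key := hσ χ hχs 1 zero_le_one
  -- the diagonal pairing is `2·Q_σ(χ)`
  have h𝔹 : ∀ i c j e, Torus.IsSmooth (fun y => Torus.Visc4.conj (G (t₀ - σ) y) 𝔸T i c j e) :=
    fun i c j e => isSmooth_conj_field (hGs (t₀ - σ)) _ i c j e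
  have hdiag := neg_integral_inner_viscAdjVar_add_transpose_self h𝔹 hχs
  have eT : (fun y => Torus.majorTranspose (Torus.Visc4.conj (G (t₀ - σ) y) 𝔸T))
      = fun y => Torus.Visc4.conj (G (t₀ - σ) y) (Torus.majorTranspose 𝔸T) := by
    funext y; rw [Torus.Visc4.conj_majorTranspose]
  rw [eT] at hdiag
  have eQ : ∫ x, ∑ l, ∑ i, ∑ c, ∑ e, Torus.Visc4.conj (G (t₀ - σ) x) 𝔸T i c l e * (Torus.partialDeriv c χ x) i * (Torus.partialDeriv e χ x) l
      = ∫ x, ∑ l, ∑ i, ∑ c, ∑ e, Torus.Visc4.conj (G (t₀ - σ) x) (Torus.majorTranspose 𝔸T) i c l e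
          * (Torus.partialDeriv c χ x) i * (Torus.partialDeriv e χ x) l := by
    refine integral_congr_ae (Eventually.of_forall fun x => ?_)
    beta_reduce
    rw [Torus.Visc4.conj_majorTranspose, quadForm_majorTranspose]
  rw [eQ] at hdiag
  rw [hdiag] at key
  linarith

end Summit.AnomalousDissipation.AnomalousDissipation.Theorems.SolenoidalFractalHomogenisation.LagrangianStep.VmodDist

end
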